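import Literature.Analysis.FluidPDE.Wei2016Slice
import Literature.Analysis.FluidPDE.Wei2016Lemma22
import Literature.Analysis.FluidPDE.Wei2016FarFieldPointwise
import Literature.Analysis.FluidPDE.Wei2016FarFieldReal
import HarnessLib

/-!
# Wei 2016, §3, (3.6)–(3.7) and the proof of Thm. 1.1 at a fixed time:
# `d/dt A + (1−θ)(‖∇J‖² + ε^{2/3}‖∇Ω‖²) ≤ C M₂ ‖∇u‖² max{A^{4/3}/(εK)^{8/3}, r₀⁻⁴}`

Analysis/FluidPDE proof file (theorems only; no definitions, no named facts) on the way to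
`Literature.Analysis.FluidPDE.Wei2016_logModulus_regularity`
(`LeiZhang2017AxisymmetricCriteria.lean`), after D. Wei, J. Math. Anal. Appl. 435 (2016) =
arXiv:1508.03318, §3: "(3.6) … `≤ (CM₂/r(t)²) ∫_{r ≥ r(t)/2}(ε^{2/3}|∇(u_r/r)|² + ε^{2/3}Ω² + J²)`,
here `M₂ = 1 + ε^{1/3}‖Γ‖_∞ + ε^{-2/3}‖Γ‖²_∞`. By Lemma 2.1 and … we obtain (3.7)
`d/dt A ≤ (CM₂/r(t)²) min{A(t), ‖∇u(t)‖²/r(t)²}` … Combining the above two cases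
`d/dt A(t) ≤ CM₂‖∇u(t)‖² max{A^{4/3}/(εK)^{8/3}, r₀^{-4}}`."

`Wei2016.slice_ode_bound` combines, at a time `t` of a classical solution with an axisymmetric
`H^∞` slice (hypotheses as in `Wei2016.slice_inequality`, with the swirl bound `|Γ| ≤ ε` on
`{r ≤ r₀}`):

* the choice `r(t) = min{εK/a(t), r₀}` with `a(t)² = √(A + η)·√(c(e + η))`,
  `c = radialConst₂⁻²`, `e = ∫‖Du(t)‖²` (`η > 0` auxiliary; Lemma 2.2,
  `Wei2016.sq_integral_abs_swirlVelocity_le`, gives `∫₀ʳ|u_θ| ≤ r a(t)` since `‖∂_zΦ‖₂² = ‖J‖₂² ≤ A`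
  and `‖Φ‖₂² ≤ e`);
* `Wei2016.slice_inequality` at this `r(t)`;
* the far-field bounds `∫_{r>r(t)/2}(Ω² + J²) ≤ 8‖curlCLM‖² e/r(t)²` (`AxisymOuterBounds`),
  `∫_{r>r(t)/2}|∇W|² ≤ 192 e/r(t)²` (`Wei2016.setIntegral_gradSq_radVelQuot_le`), and
  `∫|∇W|² ≤ ‖Ω‖₂²` (Lemma 2.1, first estimate), whence the bracket
  `X = ε^{2/3}(F_W + F_Ω) + F_J` obeys `X ≤ 4A`, `X ≤ (192 + 8‖curlCLM‖²) e/r(t)²`;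
* the two-case bookkeeping `Wei2016.far_field_ode_bound`;

and lets `η → 0`:
`2(∫JJ' + ½ε^{2/3}∫ΩΩ') + (1−θ)(∫|∇J|² + ε^{2/3}∫|∇Ω|²)`
`  ≤ hardyConst (4^{2/3}c_e^{1/3}c^{2/3} + c_e)(θ + ε^{1/3}Γ_b + ε^{-2/3}Γ_b²) · e · max{A^{4/3}/(εK)^{8/3}, r₀⁻⁴}`
(`p = ε^{1/3}`, `A = ∫J² + ½p²∫Ω²`, `c_e = 192 + 8‖curlCLM‖²`).

## References

* D. Wei, arXiv:1508.03318, §3 (3.6)–(3.7) and proof of Thm. 1.1 (the two cases). [Wei2016]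
-/

noncomputable section

open MeasureTheory Set Function Filter Topology InnerProductSpace intervalIntegral
open scoped RealInnerProductSpace Laplacian ContDiff ENNReal Topology

namespace Literature.Analysis.FluidPDE

namespace Wei2016

section SliceODE

variable {S : Set ℝ} {v : ℝ → EuclideanSpace ℝ (Fin 3) → EuclideanSpace ℝ (Fin 3)}
  {q : ℝ → EuclideanSpace ℝ (Fin 3) → ℝ}

set_option maxHeartbeats 1600000 in
/-- **Wei 2016, (3.6)–(3.7) and the two cases, at a fixed time, with an auxiliary `η > 0`.**
See `slice_ode_bound` for the statement without `η`; here the right-hand side carries `e + η`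
and `A + η` (the radius `r(t)` is chosen from `a(t)² = √(A + η)√(c(e + η)) > 0`).
[cite: Wei2016, §3 (3.6)–(3.7), proof of Thm. 1.1] -/
theorem slice_ode_bound_add (hns : IsClassicalNSSolutionOn S 1 0 v q)
    (hS : UniqueDiffOn ℝ S) (hcl : S ⊆ closure (interior S))
    (hax : ∀ s ∈ S, IsAxisymmetric (v s)) {t : ℝ} (ht : t ∈ S)
    (hH : ∀ n : ℕ, ∫⁻ x, ‖iteratedFDeriv ℝ n (v t) x‖ₑ ^ 2 < ⊤)
    {B : ℝ} (hbB : ∀ x, ‖v t x‖ ≤ B) {B' : ℝ} (hDb : ∀ x, ‖fderiv ℝ (v t) x‖ ≤ B')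
    {ε p θ K r₀ Γb η : ℝ} (hε : 0 < ε) (hε1 : ε ≤ 1) (hp : 0 < p) (hp3 : p ^ 3 = ε) (hθ0 : 0 ≤ θ)
    (hK : 1 ≤ K) (hr₀ : 0 < r₀) (hΓb0 : 0 ≤ Γb) (hη : 0 < η)
    (hM : ε * (1 + Real.log K + Real.log K ^ 2 / 2) = θ / p)
    (hΓε : ∀ x, 0 < cylRadius x → cylRadius x ≤ r₀ → |swirl (v t) x| ≤ ε)
    (hΓb : ∀ x, |swirl (v t) x| ≤ Γb) :
    2 * ((∫ x, radVelQuot (curl (v t)) x * radVelQuot (curl (timeDerivWithin S v t)) x) +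
        p ^ 2 / 2 * ∫ x, angVortQuot (v t) x * angVortQuot (timeDerivWithin S v t) x) +
      (1 - θ) * ((∫ x, (fderiv ℝ (radVelQuot (curl (v t))) x (EuclideanSpace.single 0 1) ^ 2 +
          fderiv ℝ (radVelQuot (curl (v t))) x (EuclideanSpace.single 1 1) ^ 2 +
          fderiv ℝ (radVelQuot (curl (v t))) x (EuclideanSpace.single 2 1) ^ 2)) +
        p ^ 2 * ∫ x, (fderiv ℝ (angVortQuot (v t)) x (EuclideanSpace.single 0 1) ^ 2 +
          fderiv ℝ (angVortQuot (v t)) x (EuclideanSpace.single 1 1) ^ 2 +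
          fderiv ℝ (angVortQuot (v t)) x (EuclideanSpace.single 2 1) ^ 2)) ≤
      hardyConst * ((4 : ℝ) ^ (2 / 3 : ℝ) *
          (192 + 8 * ‖(curlCLM : (EuclideanSpace ℝ (Fin 3) →L[ℝ] EuclideanSpace ℝ (Fin 3)) →L[ℝ]
            EuclideanSpace ℝ (Fin 3))‖ ^ 2) ^ (1 / 3 : ℝ) * ((radialConst₂ ^ 2)⁻¹) ^ (2 / 3 : ℝ) +
          (192 + 8 * ‖(curlCLM : (EuclideanSpace ℝ (Fin 3) →L[ℝ] EuclideanSpace ℝ (Fin 3)) →L[ℝ]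
            EuclideanSpace ℝ (Fin 3))‖ ^ 2)) *
        (θ + p * Γb + Γb ^ 2 / p ^ 2) * ((∫ x, ‖fderiv ℝ (v t) x‖ ^ 2) + η) *
        max ((((∫ x, radVelQuot (curl (v t)) x ^ 2) + p ^ 2 / 2 * ∫ x, angVortQuot (v t) x ^ 2) + η) ^
            (4 / 3 : ℝ) / (ε * K) ^ (8 / 3 : ℝ)) (r₀ ^ 4)⁻¹ := by
  -- opaque names for the seven time-dependent integrals
  obtain ⟨IJ, hIJ⟩ : ∃ IJ : ℝ, IJ = ∫ x, radVelQuot (curl (v t)) x *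
      radVelQuot (curl (timeDerivWithin S v t)) x := ⟨_, rfl⟩
  obtain ⟨IΩ, hIΩ⟩ : ∃ IΩ : ℝ, IΩ = ∫ x, angVortQuot (v t) x * angVortQuot (timeDerivWithin S v t) x :=
    ⟨_, rfl⟩
  obtain ⟨DJ, hDJ⟩ : ∃ DJ : ℝ, DJ = ∫ x, (fderiv ℝ (radVelQuot (curl (v t))) x (EuclideanSpace.single 0 1) ^ 2 +
      fderiv ℝ (radVelQuot (curl (v t))) x (EuclideanSpace.single 1 1) ^ 2 +
      fderiv ℝ (radVelQuot (curl (v t))) x (EuclideanSpace.single 2 1) ^ 2) := ⟨_, rfl⟩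
  obtain ⟨DΩ, hDΩ⟩ : ∃ DΩ : ℝ, DΩ = ∫ x, (fderiv ℝ (angVortQuot (v t)) x (EuclideanSpace.single 0 1) ^ 2 +
      fderiv ℝ (angVortQuot (v t)) x (EuclideanSpace.single 1 1) ^ 2 +
      fderiv ℝ (angVortQuot (v t)) x (EuclideanSpace.single 2 1) ^ 2) := ⟨_, rfl⟩
  obtain ⟨EJ, hEJ⟩ : ∃ EJ : ℝ, EJ = ∫ x, radVelQuot (curl (v t)) x ^ 2 := ⟨_, rfl⟩
  obtain ⟨EΩ, hEΩ⟩ : ∃ EΩ : ℝ, EΩ = ∫ x, angVortQuot (v t) x ^ 2 := ⟨_, rfl⟩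
  obtain ⟨e, he_def⟩ : ∃ e : ℝ, e = ∫ x, ‖fderiv ℝ (v t) x‖ ^ 2 := ⟨_, rfl⟩
  rw [← hIJ, ← hIΩ, ← hDJ, ← hDΩ, ← hEJ, ← hEΩ, ← he_def]
  -- small constants
  set cω : ℝ := ‖(curlCLM : (EuclideanSpace ℝ (Fin 3) →L[ℝ] EuclideanSpace ℝ (Fin 3)) →L[ℝ]
      EuclideanSpace ℝ (Fin 3))‖ with hcω
  set ce : ℝ := 192 + 8 * cω ^ 2 with hce
  set c : ℝ := (radialConst₂ ^ 2)⁻¹ with hc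
  set A : ℝ := EJ + p ^ 2 / 2 * EΩ with hA
  set M₂ : ℝ := θ + p * Γb + Γb ^ 2 / p ^ 2 with hM₂
  ----------------------------------------------------------------
  -- smoothness and atoms (as in `slice_inequality`)
  ----------------------------------------------------------------
  have haxu : IsAxisymmetric (v t) := hax t ht
  have hu : ContDiff ℝ ∞ (v t) := hns.contDiff_velocity ht
  have hu1 : ContDiff ℝ 1 (v t) := hu.of_le (by norm_cast)
  have hu2 : ContDiff ℝ 2 (v t) := hu.of_le (by norm_cast)
  have hu3 : ContDiff ℝ 3 (v t) := hu.of_le (by norm_cast)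
  have hu4 : ContDiff ℝ 4 (v t) := hu.of_le (by norm_cast)
  have hud : Differentiable ℝ (v t) := hu1.differentiable one_ne_zero
  have hω : ContDiff ℝ ∞ (curl (v t)) := by
    rw [curl_eq_curlCLM_comp]
    exact curlCLM.contDiff.comp (hu.fderiv_right (m := ∞) (by simp))
  have haxω : IsAxisymmetric (curl (v t)) := haxu.curl hud
  have hΩs : ContDiff ℝ ∞ (angVortQuot (v t)) := contDiff_angVortQuot_of_contDiff hu
  have hJs : ContDiff ℝ ∞ (radVelQuot (curl (v t))) := contDiff_radVelQuot_of_contDiff hω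
  have hWs : ContDiff ℝ ∞ (radVelQuot (v t)) := contDiff_radVelQuot_of_contDiff hu
  have hΦs : ContDiff ℝ ∞ (angVelQuot (v t)) := contDiff_angVelQuot_of_contDiff hu
  have hωfin := lintegral_sq_iteratedFDeriv_curl_lt_top hu hH
  have hΩfin := haxu.lintegral_sq_iteratedFDeriv_angVortQuot_lt_top hu hH
  have hWfin := haxu.lintegral_sq_iteratedFDeriv_radVelQuot_lt_top hu hH
  have hΦfin := haxu.lintegral_sq_iteratedFDeriv_angVelQuot_lt_top hu hH
  have hJfin := haxω.lintegral_sq_iteratedFDeriv_radVelQuot_lt_top hω hωfin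
  have hn := norm_euclideanSpace_single_one_le
  have aΩ0 : MemLp (angVortQuot (v t)) 2 volume := memLp_of_sobolev hΩs hΩfin
  have aJ0 : MemLp (radVelQuot (curl (v t))) 2 volume := memLp_of_sobolev hJs hJfin
  have aW0 : MemLp (radVelQuot (v t)) 2 volume := memLp_of_sobolev hWs hWfin
  have aΦ0 : MemLp (angVelQuot (v t)) 2 volume := memLp_of_sobolev hΦs hΦfin
  have aΩ1 : ∀ i : Fin 3, MemLp (fun x => fderiv ℝ (angVortQuot (v t)) x (EuclideanSpace.single i 1)) 2 volume :=
    fun i => memLp_fderiv_apply_of_sobolev hΩs hΩfin (hn i)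
  have aW1 : ∀ i : Fin 3, MemLp (fun x => fderiv ℝ (radVelQuot (v t)) x (EuclideanSpace.single i 1)) 2 volume :=
    fun i => memLp_fderiv_apply_of_sobolev hWs hWfin (hn i)
  have aW2 : ∀ i j : Fin 3, MemLp (fun x => fderiv ℝ (fun y => fderiv ℝ (radVelQuot (v t)) y
      (EuclideanSpace.single i 1)) x (EuclideanSpace.single j 1)) 2 volume :=
    fun i j => memLp_fderiv_fderiv_apply_of_sobolev hWs hWfin (hn i) (hn j)
  have aWq : MemLp (radDerivQuot (radVelQuot (v t))) 2 volume := (memLp_radDerivQuot_of_sobolev hWs hWfin).1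
  -- `Du ∈ L²`
  have iDu : Integrable (fun x => ‖fderiv ℝ (v t) x‖ ^ 2) volume := by
    have hM : MemLp (fderiv ℝ (v t)) 2 volume :=
      memLp_two_of_norm_le_of_lintegral (hu1.continuous_fderiv one_ne_zero)
        (fun x => (norm_iteratedFDeriv_one (𝕜 := ℝ) (f := v t) (x := x)).symm.le) (hH 1)
    exact (memLp_two_iff_integrable_sq_norm hM.1).1 hM
  have hdiv : VectorCalculus.IsDivFree (v t) := hns.divFree t ht
  ----------------------------------------------------------------
  -- elementary signs
  ----------------------------------------------------------------
  have hp1 : p ≤ 1 := le_of_not_gt fun hcon => by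
    have h3 : 1 < p ^ 3 := one_lt_pow₀ hcon (by norm_num)
    linarith only [h3, hp3, hε1]
  have hp2le : p ^ 2 ≤ 1 := pow_le_one₀ hp.le hp1
  have hcω0 : 0 ≤ cω := by
    rw [hcω]
    exact norm_nonneg (curlCLM : (EuclideanSpace ℝ (Fin 3) →L[ℝ] EuclideanSpace ℝ (Fin 3)) →L[ℝ]
      EuclideanSpace ℝ (Fin 3))
  have hce0 : 0 ≤ ce := by rw [hce]; positivity
  have hc0 : 0 < c := by rw [hc]; exact inv_pos.2 (pow_pos radialConst₂_pos 2)
  have hEJ0 : 0 ≤ EJ := by rw [hEJ]; exact integral_nonneg fun x => sq_nonneg _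
  have hEΩ0 : 0 ≤ EΩ := by rw [hEΩ]; exact integral_nonneg fun x => sq_nonneg _
  have he0 : 0 ≤ e := by rw [he_def]; exact integral_nonneg fun x => sq_nonneg _
  have hA0 : 0 ≤ A := by rw [hA]; positivity
  have hA' : 0 < A + η := by linarith
  have he' : 0 < e + η := by linarith
  have hM₂0 : 0 ≤ M₂ := by rw [hM₂]; positivity
  have hL : 0 < ε * K := mul_pos hε (by linarith)
  ----------------------------------------------------------------
  -- Lemma 2.2: the ray bound with `a² = √(A+η) √(c(e+η))`
  ----------------------------------------------------------------
  have hΦB : ∀ x, |angVelQuot (v t) x| ≤ ‖fderiv ℝ (v t) x‖ := fun x =>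
    haxu.abs_angVelQuot_le_norm_fderiv hu2 x
  have hzJ : ∀ x, fderiv ℝ (angVelQuot (v t)) x eZ = -radVelQuot (curl (v t)) x := fun x => by
    have h := haxu.radVelQuot_curl_eq_neg_fderiv_angVelQuot hu3 x
    show fderiv ℝ (angVelQuot (v t)) x (EuclideanSpace.single 2 1) = -radVelQuot (curl (v t)) x
    linarith
  have iΦz : Integrable (fun x => fderiv ℝ (angVelQuot (v t)) x eZ ^ 2) volume := by
    refine aJ0.integrable_sq.congr (Eventually.of_forall fun x => ?_)
    show radVelQuot (curl (v t)) x ^ 2 = fderiv ℝ (angVelQuot (v t)) x eZ ^ 2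
    rw [hzJ x, neg_sq]
  have hIz : ∫ x, fderiv ℝ (angVelQuot (v t)) x eZ ^ 2 = EJ := by
    rw [hEJ]
    exact integral_congr_ae (Eventually.of_forall fun x => by
      show fderiv ℝ (angVelQuot (v t)) x eZ ^ 2 = radVelQuot (curl (v t)) x ^ 2
      rw [hzJ x, neg_sq])
  have hΦ2 : ∫ x, angVelQuot (v t) x ^ 2 ≤ e := by
    rw [he_def]
    exact integral_mono aΦ0.integrable_sq iDu fun x => by
      have h := hΦB x
      show angVelQuot (v t) x ^ 2 ≤ ‖fderiv ℝ (v t) x‖ ^ 2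
      rw [← sq_abs (angVelQuot (v t) x)]
      exact pow_le_pow_left₀ (abs_nonneg _) h 2
  have hΦ20 : 0 ≤ ∫ x, angVelQuot (v t) x ^ 2 := integral_nonneg fun x => sq_nonneg _
  set a : ℝ := Real.sqrt (Real.sqrt (A + η) * Real.sqrt (c * (e + η))) with ha_def
  have hprod : 0 < Real.sqrt (A + η) * Real.sqrt (c * (e + η)) :=
    mul_pos (Real.sqrt_pos.2 hA') (Real.sqrt_pos.2 (mul_pos hc0 he'))
  have ha : 0 < a := Real.sqrt_pos.2 hprod
  have ha2 : a ^ 2 = Real.sqrt (A + η) * Real.sqrt (c * (e + η)) := Real.sq_sqrt hprod.le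
  have hsqc : Real.sqrt c = radialConst₂⁻¹ := by
    rw [hc, Real.sqrt_inv, Real.sqrt_sq radialConst₂_pos.le]
  have hkey : Real.sqrt ((∫ x, fderiv ℝ (angVelQuot (v t)) x eZ ^ 2) * ∫ x, angVelQuot (v t) x ^ 2) /
      radialConst₂ ≤ a ^ 2 := by
    rw [hIz, ha2, Real.sqrt_mul' _ he'.le, hsqc, Real.sqrt_mul hEJ0]
    rw [div_eq_mul_inv]
    have h1 : Real.sqrt EJ ≤ Real.sqrt (A + η) := Real.sqrt_le_sqrt (by
      rw [hA]
      linarith only [mul_nonneg (by positivity : (0 : ℝ) ≤ p ^ 2 / 2) hEΩ0, hη.le])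
    have h2 : Real.sqrt (∫ x, angVelQuot (v t) x ^ 2) ≤ Real.sqrt (e + η) :=
      Real.sqrt_le_sqrt (by linarith only [hΦ2, hη.le])
    calc Real.sqrt EJ * Real.sqrt (∫ x, angVelQuot (v t) x ^ 2) * radialConst₂⁻¹
        ≤ Real.sqrt (A + η) * Real.sqrt (e + η) * radialConst₂⁻¹ :=
          mul_le_mul_of_nonneg_right (mul_le_mul h1 h2 (Real.sqrt_nonneg _) (Real.sqrt_nonneg _))
            (inv_nonneg.2 radialConst₂_pos.le)
      _ = Real.sqrt (A + η) * (radialConst₂⁻¹ * Real.sqrt (e + η)) := by ring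
  set r₁ : ℝ := min (ε * K / a) r₀ with hr₁_def
  have hr₁ : 0 < r₁ := lt_min (div_pos hL ha) hr₀
  have hr₁K : r₁ ≤ ε * K / a := min_le_left _ _
  have hr₁r₀ : r₁ ≤ r₀ := min_le_right _ _
  have hΓε' : ∀ x, 0 < cylRadius x → cylRadius x ≤ r₁ → |swirl (v t) x| ≤ ε := fun x hx hxr =>
    hΓε x hx (hxr.trans hr₁r₀)
  have hray : ∀ z r : ℝ, 0 < r → r ≤ r₁ →
      ∫ s in (0 : ℝ)..r, |swirlVelocity (v t) (meridianPoint (s, z))| ≤ r * a := by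
    intro z r hr _
    have h22 := sq_integral_abs_swirlVelocity_le haxu hu4 iΦz aΦ0.integrable_sq hr z
    have hsq : (∫ s in (0 : ℝ)..r, |swirlVelocity (v t) (meridianPoint (s, z))|) ^ 2 ≤ (r * a) ^ 2 := by
      rw [mul_pow]
      exact h22.trans (by
        rw [mul_div_assoc]
        exact mul_le_mul_of_nonneg_left hkey (sq_nonneg _))
    exact (abs_le_of_sq_le_sq' hsq (by positivity)).2
  ----------------------------------------------------------------
  -- the slice inequality at `r₁`
  ----------------------------------------------------------------
  have hsl0 := slice_inequality hns hS hcl hax ht hH hbB hDb hε hp hp3 hθ0 hK hr₁ ha hr₁K hM hΓε' hΓb hray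
  obtain ⟨FW, hFW⟩ : ∃ FW : ℝ, FW = ∫ x in {x | r₁ / 2 < cylRadius x},
      (fderiv ℝ (radVelQuot (v t)) x (EuclideanSpace.single 0 1) ^ 2 +
        fderiv ℝ (radVelQuot (v t)) x (EuclideanSpace.single 1 1) ^ 2 +
        fderiv ℝ (radVelQuot (v t)) x (EuclideanSpace.single 2 1) ^ 2) := ⟨_, rfl⟩
  obtain ⟨FΩ, hFΩ⟩ : ∃ FΩ : ℝ, FΩ = ∫ x in {x | r₁ / 2 < cylRadius x}, angVortQuot (v t) x ^ 2 := ⟨_, rfl⟩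
  obtain ⟨FJ, hFJ⟩ : ∃ FJ : ℝ, FJ = ∫ x in {x | r₁ / 2 < cylRadius x}, radVelQuot (curl (v t)) x ^ 2 :=
    ⟨_, rfl⟩
  rw [← hIJ, ← hIΩ, ← hDJ, ← hDΩ, ← hFW, ← hFΩ, ← hFJ] at hsl0
  set C₁ : ℝ := hardyConst * (Γb + θ / p) / r₁ ^ 2 with hC₁
  set C₂ : ℝ := hardyConst * (Γb ^ 2 + θ * p ^ 2) / r₁ ^ 2 with hC₂
  have hsl : IJ + p ^ 2 / 2 * IΩ + (1 - θ) / 2 * DJ + (1 - θ) * (p ^ 2 / 2) * DΩ ≤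
      C₂ / 2 * FW + p ^ 2 / 2 * (p * C₁ * FΩ + p⁻¹ * C₁ * FJ) := hsl0
  ----------------------------------------------------------------
  -- far-field bounds
  ----------------------------------------------------------------
  have hδ : 0 < r₁ / 2 := by positivity
  have iNW : Integrable (fun x => fderiv ℝ (radVelQuot (v t)) x (EuclideanSpace.single 0 1) ^ 2 +
      fderiv ℝ (radVelQuot (v t)) x (EuclideanSpace.single 1 1) ^ 2 +
      fderiv ℝ (radVelQuot (v t)) x (EuclideanSpace.single 2 1) ^ 2) volume :=
    ((aW1 0).integrable_sq.add (aW1 1).integrable_sq).add (aW1 2).integrable_sq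
  have hNW0 : ∀ x, 0 ≤ fderiv ℝ (radVelQuot (v t)) x (EuclideanSpace.single 0 1) ^ 2 +
      fderiv ℝ (radVelQuot (v t)) x (EuclideanSpace.single 1 1) ^ 2 +
      fderiv ℝ (radVelQuot (v t)) x (EuclideanSpace.single 2 1) ^ 2 := fun x => by positivity
  have hFW0 : 0 ≤ FW := by
    rw [hFW]; exact setIntegral_nonneg (measurableSet_lt_cylRadius _) fun x _ => hNW0 x
  have hFΩ0 : 0 ≤ FΩ := by
    rw [hFΩ]; exact setIntegral_nonneg (measurableSet_lt_cylRadius _) fun x _ => sq_nonneg _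
  have hFJ0 : 0 ≤ FJ := by
    rw [hFJ]; exact setIntegral_nonneg (measurableSet_lt_cylRadius _) fun x _ => sq_nonneg _
  have hFWN : FW ≤ ∫ x, (fderiv ℝ (radVelQuot (v t)) x (EuclideanSpace.single 0 1) ^ 2 +
      fderiv ℝ (radVelQuot (v t)) x (EuclideanSpace.single 1 1) ^ 2 +
      fderiv ℝ (radVelQuot (v t)) x (EuclideanSpace.single 2 1) ^ 2) := by
    rw [hFW]; exact setIntegral_le_integral iNW (Eventually.of_forall hNW0)
  have hFΩE : FΩ ≤ EΩ := by
    rw [hFΩ, hEΩ]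
    exact setIntegral_le_integral aΩ0.integrable_sq (Eventually.of_forall fun x => sq_nonneg _)
  have hFJE : FJ ≤ EJ := by
    rw [hFJ, hEJ]
    exact setIntegral_le_integral aJ0.integrable_sq (Eventually.of_forall fun x => sq_nonneg _)
  -- Lemma 2.1, first estimate: `∫ |∇W|² ≤ ∫ Ω²`
  have hNWE : ∫ x, (fderiv ℝ (radVelQuot (v t)) x (EuclideanSpace.single 0 1) ^ 2 +
      fderiv ℝ (radVelQuot (v t)) x (EuclideanSpace.single 1 1) ^ 2 +
      fderiv ℝ (radVelQuot (v t)) x (EuclideanSpace.single 2 1) ^ 2) ≤ EΩ := by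
    rw [hEΩ]
    exact haxu.integral_gradSq_radVelQuot_le hu4 hdiv aW0 aWq (aW1 0) (aW1 1) (aW1 2) (aW2 0 0) (aW2 1 1)
      (aW2 2 2) aΩ0 (aΩ1 2)
  -- outer bounds against `e = ∫ ‖Du‖²`
  have igi : Integrable (fun x => (cω * ‖fderiv ℝ (v t) x‖) ^ 2) volume :=
    (iDu.const_mul (cω ^ 2)).congr (Eventually.of_forall fun x => by ring)
  have hge : ∫ x, (cω * ‖fderiv ℝ (v t) x‖) ^ 2 = cω ^ 2 * e := by
    rw [he_def, ← MeasureTheory.integral_const_mul]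
    exact integral_congr_ae (Eventually.of_forall fun x => by ring)
  have hωQ : ∀ x, ‖curl (v t) x‖ / cylRadius x ≤ cω * ‖fderiv ℝ (v t) x‖ / cylRadius x := fun x =>
    div_le_div_of_nonneg_right (norm_curl_le (v t) x) (cylRadius_nonneg x)
  have hFΩe : FΩ ≤ (r₁ / 2)⁻¹ ^ 2 * (cω ^ 2 * e) := by
    rw [← hge, hFΩ]
    exact setIntegral_sq_le_of_abs_le_div hδ
      (fun x hx => (haxu.abs_angVortQuot_le_norm_curl_div hu3 hx).trans (hωQ x))
      aΩ0.integrable_sq.integrableOn igi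
  have hFJe : FJ ≤ (r₁ / 2)⁻¹ ^ 2 * (cω ^ 2 * e) := by
    rw [← hge, hFJ]
    exact setIntegral_sq_le_of_abs_le_div hδ
      (fun x hx => (haxu.abs_radVelQuot_curl_le_norm_curl_div hu3 hx).trans (hωQ x))
      aJ0.integrable_sq.integrableOn igi
  have hFWe : FW ≤ 48 / (r₁ / 2) ^ 2 * e := by
    rw [hFW, he_def]
    exact setIntegral_gradSq_radVelQuot_le haxu hu3 hδ iNW.integrableOn iDu
  -- the bracket `X = p²(F_W + F_Ω) + F_J`
  set X : ℝ := p ^ 2 * (FW + FΩ) + FJ with hX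
  have hXA : X ≤ 4 * (A + η) := by
    have h1 : FW + FΩ ≤ 2 * EΩ := by linarith only [hFWN.trans hNWE, hFΩE]
    have h2 : p ^ 2 * (FW + FΩ) ≤ p ^ 2 * (2 * EΩ) := mul_le_mul_of_nonneg_left h1 (sq_nonneg _)
    rw [hX, hA]
    linarith only [h2, hFJE, hEJ0, hη.le]
  have hr2 : 0 < r₁ ^ 2 := pow_pos hr₁ 2
  have hr₁2 : (r₁ / 2)⁻¹ ^ 2 * (cω ^ 2 * e) = 4 * cω ^ 2 * e / r₁ ^ 2 := by
    field_simp
    ring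
  have hr₁2' : 48 / (r₁ / 2) ^ 2 * e = 192 * e / r₁ ^ 2 := by
    field_simp
    ring
  rw [hr₁2] at hFΩe hFJe
  rw [hr₁2'] at hFWe
  have eW : FW * r₁ ^ 2 ≤ 192 * e := (le_div_iff₀ hr2).1 hFWe
  have eΩ : FΩ * r₁ ^ 2 ≤ 4 * cω ^ 2 * e := (le_div_iff₀ hr2).1 hFΩe
  have eJ' : FJ * r₁ ^ 2 ≤ 4 * cω ^ 2 * e := (le_div_iff₀ hr2).1 hFJe
  have hXr : X * r₁ ^ 2 ≤ ce * e := by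
    rw [hX, hce]
    have hce' : 0 ≤ cω ^ 2 * e := by positivity
    have k1 : p ^ 2 * (FW * r₁ ^ 2) ≤ p ^ 2 * (192 * e) := mul_le_mul_of_nonneg_left eW (sq_nonneg p)
    have k2 : p ^ 2 * (FΩ * r₁ ^ 2) ≤ p ^ 2 * (4 * cω ^ 2 * e) := mul_le_mul_of_nonneg_left eΩ (sq_nonneg p)
    have k3 : p ^ 2 * (192 * e + 4 * cω ^ 2 * e) ≤ 1 * (192 * e + 4 * cω ^ 2 * e) :=
      mul_le_mul_of_nonneg_right hp2le (by positivity)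
    have kx : (p ^ 2 * (FW + FΩ) + FJ) * r₁ ^ 2 =
        p ^ 2 * (FW * r₁ ^ 2) + p ^ 2 * (FΩ * r₁ ^ 2) + FJ * r₁ ^ 2 := by ring
    rw [kx]
    linarith only [k1, k2, k3, eJ', hce']
  have hXe' : X * r₁ ^ 2 ≤ ce * (e + η) := by linarith only [hXr, mul_nonneg hce0 hη.le]
  have hXe : X ≤ ce * (e + η) / (min (ε * K / a) r₀) ^ 2 := by
    show X ≤ ce * (e + η) / r₁ ^ 2
    exact (le_div_iff₀ hr2).2 hXe'
  ----------------------------------------------------------------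
  -- the two cases (`far_field_ode_bound`)
  ----------------------------------------------------------------
  have ha2le : a ^ 2 ≤ Real.sqrt (A + η) * Real.sqrt (c * (e + η)) := ha2.le
  have hfar0 := far_field_ode_bound (A := A + η) (e := e + η) (X := X) (cA := 4) (ce := ce) (c := c)
    hA'.le he'.le (by norm_num) hce0 hc0.le ha hL hr₀ hXA hXe ha2le
  have hfar : X / r₁ ^ 2 ≤ ((4 : ℝ) ^ (2 / 3 : ℝ) * ce ^ (1 / 3 : ℝ) * c ^ (2 / 3 : ℝ) + ce) * (e + η) *
      max ((A + η) ^ (4 / 3 : ℝ) / (ε * K) ^ (8 / 3 : ℝ)) (r₀ ^ 4)⁻¹ := hfar0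
  ----------------------------------------------------------------
  -- the coefficients: `C₂/2 F_W + p²/2 (p C₁ F_Ω + p⁻¹ C₁ F_J) ≤ hardyConst M₂/(2 r₁²) X`
  ----------------------------------------------------------------
  have hκ : 0 ≤ hardyConst / (2 * r₁ ^ 2) := div_nonneg hardyConst_nonneg (by positivity)
  have hLHS : C₂ / 2 * FW + p ^ 2 / 2 * (p * C₁ * FΩ + p⁻¹ * C₁ * FJ) =
      hardyConst / (2 * r₁ ^ 2) *
        ((Γb ^ 2 + θ * p ^ 2) * FW + (p ^ 3 * Γb + θ * p ^ 2) * FΩ + (p * Γb + θ) * FJ) := by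
    rw [hC₁, hC₂]
    field_simp
    ring
  have hbd : (Γb ^ 2 + θ * p ^ 2) * FW + (p ^ 3 * Γb + θ * p ^ 2) * FΩ + (p * Γb + θ) * FJ ≤ M₂ * X := by
    rw [hM₂, hX]
    have hp2 : 0 < p ^ 2 := pow_pos hp 2
    have hM₂p : (θ + p * Γb + Γb ^ 2 / p ^ 2) * p ^ 2 = θ * p ^ 2 + p ^ 3 * Γb + Γb ^ 2 := by
      field_simp
    have t1 : (Γb ^ 2 + θ * p ^ 2) * FW ≤ (θ + p * Γb + Γb ^ 2 / p ^ 2) * p ^ 2 * FW := by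
      rw [hM₂p]
      exact mul_le_mul_of_nonneg_right
        (by linarith only [mul_nonneg (pow_nonneg hp.le 3) hΓb0]) hFW0
    have t2 : (p ^ 3 * Γb + θ * p ^ 2) * FΩ ≤ (θ + p * Γb + Γb ^ 2 / p ^ 2) * p ^ 2 * FΩ := by
      rw [hM₂p]
      exact mul_le_mul_of_nonneg_right (by linarith only [sq_nonneg Γb]) hFΩ0
    have t3 : (p * Γb + θ) * FJ ≤ (θ + p * Γb + Γb ^ 2 / p ^ 2) * FJ :=
      mul_le_mul_of_nonneg_right (by linarith only [div_nonneg (sq_nonneg Γb) hp2.le]) hFJ0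
    have ksum : (θ + p * Γb + Γb ^ 2 / p ^ 2) * (p ^ 2 * (FW + FΩ) + FJ) =
        (θ + p * Γb + Γb ^ 2 / p ^ 2) * p ^ 2 * FW + (θ + p * Γb + Γb ^ 2 / p ^ 2) * p ^ 2 * FΩ +
          (θ + p * Γb + Γb ^ 2 / p ^ 2) * FJ := by ring
    rw [ksum]
    linarith only [t1, t2, t3]
  have hRHS : C₂ / 2 * FW + p ^ 2 / 2 * (p * C₁ * FΩ + p⁻¹ * C₁ * FJ) ≤
      hardyConst / (2 * r₁ ^ 2) * (M₂ * X) := by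
    rw [hLHS]
    exact mul_le_mul_of_nonneg_left hbd hκ
  ----------------------------------------------------------------
  -- assemble
  ----------------------------------------------------------------
  have hfin : hardyConst / (2 * r₁ ^ 2) * (M₂ * X) = hardyConst * M₂ * (X / r₁ ^ 2) / 2 := by
    field_simp
  calc 2 * (IJ + p ^ 2 / 2 * IΩ) + (1 - θ) * (DJ + p ^ 2 * DΩ)
      = 2 * (IJ + p ^ 2 / 2 * IΩ + (1 - θ) / 2 * DJ + (1 - θ) * (p ^ 2 / 2) * DΩ) := by ring
    _ ≤ 2 * (hardyConst / (2 * r₁ ^ 2) * (M₂ * X)) := by linarith only [hsl.trans hRHS]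
    _ = hardyConst * M₂ * (X / r₁ ^ 2) := by rw [hfin]; ring
    _ ≤ hardyConst * M₂ * (((4 : ℝ) ^ (2 / 3 : ℝ) * ce ^ (1 / 3 : ℝ) * c ^ (2 / 3 : ℝ) + ce) * (e + η) *
        max ((A + η) ^ (4 / 3 : ℝ) / (ε * K) ^ (8 / 3 : ℝ)) (r₀ ^ 4)⁻¹) :=
        mul_le_mul_of_nonneg_left hfar (mul_nonneg hardyConst_nonneg hM₂0)
    _ = hardyConst * ((4 : ℝ) ^ (2 / 3 : ℝ) * ce ^ (1 / 3 : ℝ) * c ^ (2 / 3 : ℝ) + ce) * M₂ * (e + η) *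
        max ((A + η) ^ (4 / 3 : ℝ) / (ε * K) ^ (8 / 3 : ℝ)) (r₀ ^ 4)⁻¹ := by ring

/-- **Wei 2016, (3.6)–(3.7) and the two cases of the proof of Thm. 1.1, at a fixed time**:
for a classical solution of the unforced system (`ν = 1`) on `S ⊆ closure (interior S)` with
axisymmetric slices, at a time `t ∈ S` with `v t ∈ H^∞`, `v t`, `Dv(t)` bounded, and parameters
`0 < ε ≤ 1`, `p³ = ε`, `0 ≤ θ`, `K ≥ 1`, `r₀ > 0`, `ε(1 + ln K + ½ln²K) = θ/p`, `|Γ| ≤ ε` on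
`{0 < r ≤ r₀}`, `|Γ| ≤ Γ_b`:
`2(∫JJ' + ½p²∫ΩΩ') + (1 − θ)(∫|∇J|² + p²∫|∇Ω|²)`
`  ≤ hardyConst (4^{2/3}c_e^{1/3}c^{2/3} + c_e)(θ + pΓ_b + Γ_b²/p²) · (∫‖Dv(t)‖²) · max{A^{4/3}/(εK)^{8/3}, r₀⁻⁴}`,
`A = ∫J² + ½p²∫Ω²`, `c_e = 192 + 8‖curlCLM‖²`, `c = radialConst₂⁻²` (the radius
`r(t) = min{εK/a(t), r₀}` of Lemma 2.3 being chosen inside, through Lemma 2.2).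
[cite: Wei2016, §3 (3.6)–(3.7), proof of Thm. 1.1] -/
theorem slice_ode_bound (hns : IsClassicalNSSolutionOn S 1 0 v q)
    (hS : UniqueDiffOn ℝ S) (hcl : S ⊆ closure (interior S))
    (hax : ∀ s ∈ S, IsAxisymmetric (v s)) {t : ℝ} (ht : t ∈ S)
    (hH : ∀ n : ℕ, ∫⁻ x, ‖iteratedFDeriv ℝ n (v t) x‖ₑ ^ 2 < ⊤)
    {B : ℝ} (hbB : ∀ x, ‖v t x‖ ≤ B) {B' : ℝ} (hDb : ∀ x, ‖fderiv ℝ (v t) x‖ ≤ B')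
    {ε p θ K r₀ Γb : ℝ} (hε : 0 < ε) (hε1 : ε ≤ 1) (hp : 0 < p) (hp3 : p ^ 3 = ε) (hθ0 : 0 ≤ θ)
    (hK : 1 ≤ K) (hr₀ : 0 < r₀) (hΓb0 : 0 ≤ Γb)
    (hM : ε * (1 + Real.log K + Real.log K ^ 2 / 2) = θ / p)
    (hΓε : ∀ x, 0 < cylRadius x → cylRadius x ≤ r₀ → |swirl (v t) x| ≤ ε)
    (hΓb : ∀ x, |swirl (v t) x| ≤ Γb) :
    2 * ((∫ x, radVelQuot (curl (v t)) x * radVelQuot (curl (timeDerivWithin S v t)) x) +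
        p ^ 2 / 2 * ∫ x, angVortQuot (v t) x * angVortQuot (timeDerivWithin S v t) x) +
      (1 - θ) * ((∫ x, (fderiv ℝ (radVelQuot (curl (v t))) x (EuclideanSpace.single 0 1) ^ 2 +
          fderiv ℝ (radVelQuot (curl (v t))) x (EuclideanSpace.single 1 1) ^ 2 +
          fderiv ℝ (radVelQuot (curl (v t))) x (EuclideanSpace.single 2 1) ^ 2)) +
        p ^ 2 * ∫ x, (fderiv ℝ (angVortQuot (v t)) x (EuclideanSpace.single 0 1) ^ 2 +
          fderiv ℝ (angVortQuot (v t)) x (EuclideanSpace.single 1 1) ^ 2 +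
          fderiv ℝ (angVortQuot (v t)) x (EuclideanSpace.single 2 1) ^ 2)) ≤
      hardyConst * ((4 : ℝ) ^ (2 / 3 : ℝ) *
          (192 + 8 * ‖(curlCLM : (EuclideanSpace ℝ (Fin 3) →L[ℝ] EuclideanSpace ℝ (Fin 3)) →L[ℝ]
            EuclideanSpace ℝ (Fin 3))‖ ^ 2) ^ (1 / 3 : ℝ) * ((radialConst₂ ^ 2)⁻¹) ^ (2 / 3 : ℝ) +
          (192 + 8 * ‖(curlCLM : (EuclideanSpace ℝ (Fin 3) →L[ℝ] EuclideanSpace ℝ (Fin 3)) →L[ℝ]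
            EuclideanSpace ℝ (Fin 3))‖ ^ 2)) *
        (θ + p * Γb + Γb ^ 2 / p ^ 2) * (∫ x, ‖fderiv ℝ (v t) x‖ ^ 2) *
        max ((((∫ x, radVelQuot (curl (v t)) x ^ 2) + p ^ 2 / 2 * ∫ x, angVortQuot (v t) x ^ 2)) ^
            (4 / 3 : ℝ) / (ε * K) ^ (8 / 3 : ℝ)) (r₀ ^ 4)⁻¹ := by
  -- opaque names
  obtain ⟨L, hL⟩ : ∃ L : ℝ, L =
      2 * ((∫ x, radVelQuot (curl (v t)) x * radVelQuot (curl (timeDerivWithin S v t)) x) +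
        p ^ 2 / 2 * ∫ x, angVortQuot (v t) x * angVortQuot (timeDerivWithin S v t) x) +
      (1 - θ) * ((∫ x, (fderiv ℝ (radVelQuot (curl (v t))) x (EuclideanSpace.single 0 1) ^ 2 +
          fderiv ℝ (radVelQuot (curl (v t))) x (EuclideanSpace.single 1 1) ^ 2 +
          fderiv ℝ (radVelQuot (curl (v t))) x (EuclideanSpace.single 2 1) ^ 2)) +
        p ^ 2 * ∫ x, (fderiv ℝ (angVortQuot (v t)) x (EuclideanSpace.single 0 1) ^ 2 +
          fderiv ℝ (angVortQuot (v t)) x (EuclideanSpace.single 1 1) ^ 2 +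
          fderiv ℝ (angVortQuot (v t)) x (EuclideanSpace.single 2 1) ^ 2)) := ⟨_, rfl⟩
  obtain ⟨Cg, hCg⟩ : ∃ Cg : ℝ, Cg = hardyConst * ((4 : ℝ) ^ (2 / 3 : ℝ) *
          (192 + 8 * ‖(curlCLM : (EuclideanSpace ℝ (Fin 3) →L[ℝ] EuclideanSpace ℝ (Fin 3)) →L[ℝ]
            EuclideanSpace ℝ (Fin 3))‖ ^ 2) ^ (1 / 3 : ℝ) * ((radialConst₂ ^ 2)⁻¹) ^ (2 / 3 : ℝ) +
          (192 + 8 * ‖(curlCLM : (EuclideanSpace ℝ (Fin 3) →L[ℝ] EuclideanSpace ℝ (Fin 3)) →L[ℝ]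
            EuclideanSpace ℝ (Fin 3))‖ ^ 2)) *
        (θ + p * Γb + Γb ^ 2 / p ^ 2) := ⟨_, rfl⟩
  obtain ⟨e, he⟩ : ∃ e : ℝ, e = ∫ x, ‖fderiv ℝ (v t) x‖ ^ 2 := ⟨_, rfl⟩
  obtain ⟨A, hA⟩ : ∃ A : ℝ, A = (∫ x, radVelQuot (curl (v t)) x ^ 2) +
      p ^ 2 / 2 * ∫ x, angVortQuot (v t) x ^ 2 := ⟨_, rfl⟩
  rw [← hL, ← hCg, ← he, ← hA]
  -- the bound for every `η > 0`
  have hη_pos : ∀ η : ℝ, 0 < η →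
      L ≤ Cg * (e + η) * max ((A + η) ^ (4 / 3 : ℝ) / (ε * K) ^ (8 / 3 : ℝ)) (r₀ ^ 4)⁻¹ := by
    intro η hη
    have h := slice_ode_bound_add hns hS hcl hax ht hH hbB hDb hε hε1 hp hp3 hθ0 hK hr₀ hΓb0 hη hM hΓε hΓb
    rw [← hL, ← hCg, ← he, ← hA] at h
    exact h
  -- `η → 0⁺`
  have hcont : Continuous fun η : ℝ =>
      Cg * (e + η) * max ((A + η) ^ (4 / 3 : ℝ) / (ε * K) ^ (8 / 3 : ℝ)) (r₀ ^ 4)⁻¹ := by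
    have h1 : Continuous fun η : ℝ => (A + η) ^ (4 / 3 : ℝ) :=
      (Real.continuous_rpow_const (by norm_num)).comp (continuous_const.add continuous_id)
    exact (continuous_const.mul (continuous_const.add continuous_id)).mul
      ((h1.div_const _).max continuous_const)
  have hlim : Tendsto (fun η : ℝ =>
      Cg * (e + η) * max ((A + η) ^ (4 / 3 : ℝ) / (ε * K) ^ (8 / 3 : ℝ)) (r₀ ^ 4)⁻¹) (𝓝[>] 0)
      (𝓝 (Cg * (e + 0) * max ((A + 0) ^ (4 / 3 : ℝ) / (ε * K) ^ (8 / 3 : ℝ)) (r₀ ^ 4)⁻¹)) :=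
    (hcont.tendsto 0).mono_left nhdsWithin_le_nhds
  rw [add_zero, add_zero] at hlim
  exact ge_of_tendsto hlim (eventually_nhdsWithin_of_forall fun η hη => hη_pos η hη)

end SliceODE

end Wei2016

end Literature.Analysis.FluidPDE

end
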